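import Summits.Ventures.CertifiedManyBodySolver.Downfold.OneBandBox
import Mathlib.Data.Fin.VecNotation
import Mathlib.Order.Interval.Set.Pi
import HarnessLib

/-!
# The S1/S2 seam in S2's own shape: a one-band box's `(U/t, tp/t, n)` entries as the delivered box
# `Set.Icc lo hi ⊆ (Fin 3 → ℝ)` of the `t–t'` box-word theorems

Venture CertifiedManyBodySolver, cell `pub/hubbard-downfold` (W3 of ROUTER.md §9: ONE structure at
the S1/S2 seam), seat hubbard-downfold-mod-1; namespace
`Summit.Ventures.CertifiedManyBodySolver.Downfold`. Everything here is PROVED. HONEST FRAMING: a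
downfolded box is a systematic modelling claim (hypothesis `B.Mem p`); the certified content is S2's.

Stage S2's box words (`Literature/MathematicalPhysics/QuantumLattice/HubbardTTPrimeBoxWordCovering`:
`forall_groundStates_le_of_gridCells₃`, `energyDensityTT'_box₃_mem_Icc`, …; cell `pub/hubbard-fast`)
quantify over a DELIVERED BOX `θ ∈ Set.Icc lo hi`, `lo hi : Fin 3 → ℝ`, coordinates ordered
`(U/t, t'/t, n)` at `t ≡ 1` — "the router's box grammar". This file is the adapter and nothing else:

* `s2Coords p = ![p UOverT, p tpOverT, p filling]` — a one-band parameter vector read in S2's order;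
  `s2Lo / s2Hi eU eS eN` — the delivered box corners from the three entries' claimed enclosures
  (rational end points cast to `ℝ`).
* `s2Coords_mem_Icc` — `B.Mem p` ⇒ `s2Coords p ∈ Set.Icc (s2Lo …) (s2Hi …)`: the delivered box of a
  one-band `Downfold.Box` IS the product of its `U/t`, `tp/t`, `n` enclosures.
* `holdsOn_of_forall_s2Box` — any S2 statement of the shape `∀ θ ∈ Set.Icc lo hi, W θ` about that
  delivered box becomes the box word `HoldsOn (fun p => W (s2Coords p)) B`; with
  `holdsOn_oneBand_of_cell` (product-of-intervals shape) these are the two doors through which a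
  certified S2 word is attached to a material. The "inside the gridded extent" side conditions of
  the covering theorems (`g k 0 ≤ lo k`, `hi k ≤ g k (N k)`) are inequalities on `s2Lo / s2Hi`,
  i.e. on the box's rational end points — decidable at hand-off.
-/

namespace Summit.Ventures.CertifiedManyBodySolver.Downfold

open NonemptyInterval

/-- A one-band parameter vector read in S2's coordinate order `(U/t, t'/t, n)`. [folklore] -/
def s2Coords (p : OneBandCoord → ℝ) : Fin 3 → ℝ := ![p .UOverT, p .tpOverT, p .filling]

/-- Lower corner of the delivered S2 box from the `U/t`, `tp/t`, `n` entries. [folklore] -/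
def s2Lo (eU eS eN : Entry) : Fin 3 → ℝ :=
  ![((eU.encl.fst : ℚ) : ℝ), ((eS.encl.fst : ℚ) : ℝ), ((eN.encl.fst : ℚ) : ℝ)]

/-- Upper corner of the delivered S2 box from the `U/t`, `tp/t`, `n` entries. [folklore] -/
def s2Hi (eU eS eN : Entry) : Fin 3 → ℝ :=
  ![((eU.encl.snd : ℚ) : ℝ), ((eS.encl.snd : ℚ) : ℝ), ((eN.encl.snd : ℚ) : ℝ)]

/-- **The delivered box of a one-band box.** If `B` carries entries `eU, eS, eN` for `U/t`, `tp/t`,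
`n`, every parameter vector of `B`, read in S2's order, lies in `Set.Icc (s2Lo eU eS eN) (s2Hi eU eS eN)`.
[folklore] -/
theorem s2Coords_mem_Icc {B : OneBandBox} {eU eS eN : Entry} (hU : B .UOverT = some eU)
    (hS : B .tpOverT = some eS) (hN : B .filling = some eN) {p : OneBandCoord → ℝ} (hp : B.Mem p) :
    s2Coords p ∈ Set.Icc (s2Lo eU eS eN) (s2Hi eU eS eN) := by
  have hu := mem_ratCast_iff.1 (hp _ _ hU)
  have hs := mem_ratCast_iff.1 (hp _ _ hS)
  have hn := mem_ratCast_iff.1 (hp _ _ hN)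
  rw [Set.mem_Icc, Pi.le_def, Pi.le_def]
  refine ⟨fun k => ?_, fun k => ?_⟩ <;> fin_cases k <;>
    simp [s2Coords, s2Lo, s2Hi, hu.1, hu.2, hs.1, hs.2, hn.1, hn.2]

/-- **S2 box statement ⇒ box word.** Any statement `∀ θ ∈ Set.Icc (s2Lo …) (s2Hi …), W θ` about the
delivered box (the conclusion shape of the `t–t'` box-word covering theorems, ground-state data and
all carried inside `W`) holds on the one-band box as `p ↦ W (s2Coords p)`. [folklore] -/
theorem holdsOn_of_forall_s2Box {B : OneBandBox} {eU eS eN : Entry} (hU : B .UOverT = some eU)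
    (hS : B .tpOverT = some eS) (hN : B .filling = some eN) {W : (Fin 3 → ℝ) → Prop}
    (hW : ∀ θ ∈ Set.Icc (s2Lo eU eS eN) (s2Hi eU eS eN), W θ) :
    HoldsOn (fun p : OneBandCoord → ℝ => W (s2Coords p)) B :=
  fun _ hp => hW _ (s2Coords_mem_Icc hU hS hN hp)

/-- The three S2 coordinates of `s2Coords p`, by name. [folklore] -/
theorem s2Coords_apply (p : OneBandCoord → ℝ) :
    s2Coords p 0 = p .UOverT ∧ s2Coords p 1 = p .tpOverT ∧ s2Coords p 2 = p .filling :=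
  ⟨rfl, rfl, rfl⟩

end Summit.Ventures.CertifiedManyBodySolver.Downfold
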